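import Summits.AtomisticToContinuum.FouriersLaw.Theorems.OddSectorIrreversibilityWitnessGlueTapLeakBlock
import Summits.AtomisticToContinuum.FouriersLaw.Theorems.OddSectorIrreversibilityCorrectorResponseNonneg
import Summits.AtomisticToContinuum.FouriersLaw.Theorems.OddSectorIrreversibilityCorrectorTheoryUniformMixing

/-!
# `WitnessGlue` (stmt-AtomisticToContinuum-15160) — PROVED: the transport-witness theorem (file 2/2)

Route `OddSectorIrreversibility` (sub-problem `FouriersLaw`), crux `WitnessGlue`, rev-17 body
`TapLeakBound → ConeScaleCorrector → SubBallisticWindow → BoundedResponse` (P → E1 → E2 → bounded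
response along every steady-state family under weak-NESS uniqueness), line `p-rate-central-block`.
This file is the `∀ N` wrapper over the one-`N` estimate `response_bound_of_tapLeak` of file 1/2
(`OddSectorIrreversibilityWitnessGlueTapLeakBlock.lean`).

* `kernelWindow_eq_window` — the route's `E2` window (zero-friction kernels) is the landed
  closed-flow `window` (zero-friction dictionary: Dirac mass at `detFlow`).
* `witnessGlue_of_correctorTheory` — instantiate `P`, `E1`, `E2` (constants replaced by `max · 0`)
  and `CorrectorTheory` A(3)(5)(6)(7)+B at each `N ≥ 16` (`⟨u,J⟩_{μ_T} = Z∫c_N` by the landed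
  `pinnedChain_integral_corrector_mul_withDensity`), apply `response_bound_of_tapLeak`, finish by
  the landed `boundedResponse_of_correctorTheory_of_eventually_le` (small `N` free, `0 ≤ D_N`).
* `witnessGlue_proof : WitnessGlue` — unconditional, since `CorrectorTheory` is PROVED
  (`Corrector.CorrectorTheory_proof`).

Sorry-free; axioms `propext`, `Classical.choice`, `Quot.sound`. References: Kundu–Dhar–Narayan 2009
(open-chain Green–Kubo, (reln2)–(reln3)); Lepri–Livi–Politi 2003 (finite-time Green–Kubo cut-off);
folklore. Candidate proof by the crux-ideate planner seat (idea `p-rate-central-block`), checked and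
landed by the line lead.
-/
noncomputable section

namespace Summit.AtomisticToContinuum.FouriersLaw.Theorems.OddSectorWitness.TapLeak

open MeasureTheory Filter Topology ProbabilityTheory Set
open scoped NNReal ENNReal
open Literature.MathematicalPhysics.KineticTheory.HeatConduction
open Summit.AtomisticToContinuum.FouriersLaw.Theorems.ClosedConeSensitivity.Negative.ZeroFrictionDictionary
open Summit.AtomisticToContinuum.FouriersLaw.Theorems.OddSectorWitness

variable {ω₂ lam β : ℝ}


/-! ## 4. The `∀ N` wrapper: `WitnessGlue` itself (from the PROVED support `CorrectorTheory`) -/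

/-- The route's `E2` window (kernel form, zero-friction kernels) is the closed-flow `window` of the
landed witness files (zero-friction dictionary: the kernel is the Dirac mass at `detFlow`). [folklore] -/
theorem kernelWindow_eq_window (hω : 0 < ω₂) (hl : 0 ≤ lam) (hβ : 0 ≤ β) (γ : ℝ) (N k₁ k₂ : ℕ)
    (T τ : ℝ) (x : PhaseSpace N) :
    (∫ t in Ioc (0 : ℝ) τ, ∫ y, (∑ i : Fin N, (if k₁ ≤ i.val ∧ i.val < k₂ then
        (pinnedChain ω₂ lam β γ).bondCurrent N i y else 0))
        ∂((pinnedChain ω₂ lam β 0).transitionKernel N T T t.toNNReal x)) =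
      window ω₂ lam β γ N k₁ k₂ τ x := by
  unfold window
  refine setIntegral_congr_fun measurableSet_Ioc (fun t ht => ?_)
  rw [integral_transitionKernel_zero_friction hω hl hβ]
  simp only [blockCurrent, Real.coe_toNNReal _ ht.1.le]

open Summit.AtomisticToContinuum.FouriersLaw.Theses.OddSectorIrreversibility in
/-- **`CorrectorTheory → WitnessGlue`**: the transport-witness theorem of route
`OddSectorIrreversibility` (rev-17 body `TapLeakBound → ConeScaleCorrector → SubBallisticWindow →
BoundedResponse`) from the fixed-`N` corrector calculus — instantiate `P`, `E1`, `E2` and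
`CorrectorTheory` A(3)(5)(6)(7)+B at each `N ≥ 16`, apply `response_bound_of_tapLeak`, and finish
with the landed `boundedResponse_of_correctorTheory_of_eventually_le` (small `N` free, `0 ≤ D_N`).
[folklore] -/
theorem witnessGlue_of_correctorTheory (hCT : CorrectorTheory) : WitnessGlue := by
  intro hP hE1 hE2
  refine Summit.AtomisticToContinuum.FouriersLaw.Theorems.boundedResponse_of_correctorTheory_of_eventually_le
    hCT ?_
  intro ω₂ lam β γ hω hl hβ hγ hU μ hμ T hT D hD
  obtain ⟨a, C, ha, hPN⟩ := hP ω₂ lam β γ hω hl hβ hγ T hT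
  obtain ⟨C₁, hE1N⟩ := hE1 ω₂ lam β γ hω hl hβ hγ T hT
  obtain ⟨C₂, hE2N⟩ := hE2 ω₂ lam β γ hω hl hβ hγ T hT
  refine ⟨2 * (64 * Real.sqrt (max C₁ 0 * max C₂ 0 * (1 + a)) / a + a * γ * max C 0 * Real.sqrt 2 / 2) / T ^ 2 +
      (4 * a * γ * max C 0 * T) ^ 2 / T ^ 4, ?_⟩
  rw [Filter.eventually_atTop]
  refine ⟨16, fun N hN => ?_⟩
  have hNpos : 0 < N := by omega
  obtain ⟨u, hu1, hu2, hu3, hu4, h5, h6, h7⟩ := hCT.1 ω₂ lam β γ hω hl hβ hγ T hT N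
  obtain ⟨hcI, hK⟩ := hCT.2 ω₂ lam β γ hω hl hβ hγ hU μ hμ T hT N (D N) (hD N)
  simp only [] at hu1 hu2 hu3 hu4 h5 h6 h7 hcI hK
  have hpair := (Summit.AtomisticToContinuum.FouriersLaw.Theorems.pinnedChain_integral_corrector_mul_withDensity
    hω hl.le hβ hγ hNpos hT hu2 hu4 hcI).2
  have hZ : 0 < ∫ x : PhaseSpace N, Real.exp (-((pinnedChain ω₂ lam β γ).hamiltonian N x) / T) :=
    integral_exp_pos (pinnedChain_integrable_gibbsDensity hω hl.le hβ.le γ N hT)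
  -- the Green–Kubo pairing `⟨u, J⟩_{μ_T} = Z (N-1) T² D_N`
  have hGK : ∫ x, u x * (∑ i : Fin N, (pinnedChain ω₂ lam β γ).bondCurrent N i x) ∂(gibbsWeight ω₂ lam β γ N T) =
      (∫ x, Real.exp (-((pinnedChain ω₂ lam β γ).hamiltonian N x) / T) ∂volume) * (((N : ℝ) - 1) * T ^ 2 * D N) := by
    rw [hK]; exact hpair
  -- the two contacts
  set b₀ : Fin N := ⟨0, by omega⟩ with hb₀def
  set b₁ : Fin N := ⟨N - 1, by omega⟩ with hb₁def
  -- the closed-flow bond currents, kernel form and flow form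
  set jt : Fin N → ℝ → PhaseSpace N → ℝ := fun i s x =>
    ∫ y, (pinnedChain ω₂ lam β γ).bondCurrent N i y ∂((pinnedChain ω₂ lam β 0).transitionKernel N T T s.toNNReal x) with hjtdef
  have hjt : ∀ i s x, jt i s x = (pinnedChain ω₂ lam β γ).bondCurrent N i (detFlow ω₂ lam β N ((s.toNNReal : ℝ≥0) : ℝ) x) :=
    fun i s x => integral_transitionKernel_zero_friction hω hl.le hβ.le N T T s.toNNReal x _
  -- E1 at this `N` and this `u`
  have hE1' : ∫ x, (u x) ^ 2 ∂(gibbsWeight ω₂ lam β γ N T) ≤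
      max C₁ 0 * (N : ℝ) ^ 2 * ∫ x, Real.exp (-((pinnedChain ω₂ lam β γ).hamiltonian N x) / T) ∂volume := by
    have h := hE1N N u
    simp only [] at h
    refine (h hu3).2.trans ?_
    exact mul_le_mul_of_nonneg_right (mul_le_mul_of_nonneg_right (le_max_left _ _) (sq_nonneg _)) hZ.le
  -- E2 at this `N`, in `window` form
  have hE2' : ∀ k₁ k₂ : ℕ, k₁ ≤ k₂ → k₂ + 1 ≤ N → ∀ τ : ℝ, 0 ≤ τ →
      ∫ x, (window ω₂ lam β γ N k₁ k₂ τ x) ^ 2 ∂(gibbsWeight ω₂ lam β γ N T) ≤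
        max C₂ 0 * (1 + τ) * ((k₂ : ℝ) - k₁) * ∫ x, Real.exp (-((pinnedChain ω₂ lam β γ).hamiltonian N x) / T) ∂volume := by
    intro k₁ k₂ hk hk₂ τ hτ
    have h := hE2N N k₁ k₂ hk hk₂ τ hτ
    simp only [] at h
    have hw : ∀ x, (window ω₂ lam β γ N k₁ k₂ τ x) ^ 2 =
        (∫ t in Ioc (0 : ℝ) τ, ∫ y, (∑ i : Fin N, (if k₁ ≤ i.val ∧ i.val < k₂ then
          (pinnedChain ω₂ lam β γ).bondCurrent N i y else 0)) ∂((pinnedChain ω₂ lam β 0).transitionKernel N T T t.toNNReal x)) ^ 2 :=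
      fun x => by rw [kernelWindow_eq_window hω hl.le hβ.le]
    have hwi := integral_congr_ae (μ := gibbsWeight ω₂ lam β γ N T) (Eventually.of_forall hw)
    rw [hwi]
    refine h.trans ?_
    have hkk : (0 : ℝ) ≤ (k₂ : ℝ) - k₁ := by
      have : (k₁ : ℝ) ≤ k₂ := by exact_mod_cast hk
      linarith
    have hfac : 0 ≤ (1 + τ) * ((k₂ : ℝ) - k₁) * ∫ x, Real.exp (-((pinnedChain ω₂ lam β γ).hamiltonian N x) / T) ∂volume := by
      positivity
    nlinarith [le_max_left C₂ 0, hfac]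
  -- P at this `N` and this `u`
  have hP' : ∀ (i b : Fin N), (b.val = 0 ∨ b.val = N - 1) → ∀ s : ℝ, 0 ≤ s →
      s ≤ a * ((if b.val = 0 then i.val else N - 2 - i.val : ℕ) : ℝ) →
      |T * ∫ x, partialP b (fun y : PhaseSpace N => (u y + u (y.1, -y.2)) / 2) x * partialP b (jt i s) x
          ∂(gibbsWeight ω₂ lam β γ N T)| ≤
        max C 0 * Real.sqrt ((|∫ x, u x * (∑ k : Fin N, (pinnedChain ω₂ lam β γ).bondCurrent N k x) ∂(gibbsWeight ω₂ lam β γ N T)| +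
            ∫ x, Real.exp (-((pinnedChain ω₂ lam β γ).hamiltonian N x) / T) ∂volume) *
          ∫ x, Real.exp (-((pinnedChain ω₂ lam β γ).hamiltonian N x) / T) ∂volume) /
        (1 + ((((if b.val = 0 then i.val else N - 2 - i.val : ℕ) : ℝ)) - s / a)) ^ (3 / 2 : ℝ) := by
    intro i b hb s hs0 hsd
    have h := hPN N i b u s hb hs0
    simp only [] at h
    have h' := h hu1 hu2 hu3 hsd
    refine h'.trans ?_
    have hbase : 0 ≤ 1 + ((((if b.val = 0 then i.val else N - 2 - i.val : ℕ) : ℝ)) - s / a) := by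
      have : s / a ≤ ((if b.val = 0 then i.val else N - 2 - i.val : ℕ) : ℝ) := by
        rw [div_le_iff₀ ha]; linarith
      linarith
    refine div_le_div_of_nonneg_right ?_ (Real.rpow_nonneg hbase _)
    exact mul_le_mul_of_nonneg_right (le_max_left _ _) (Real.sqrt_nonneg _)
  -- the one-`N` response bound
  exact (response_bound_of_tapLeak hω hl.le hβ.le γ N hT hγ ha (le_max_right C 0) (le_max_right C₁ 0)
    (le_max_right C₂ 0) hN hu2 h5 b₀ b₁ rfl rfl (h6 b₀ b₁ rfl rfl) jt hjt
    (fun i t ht => h7 i b₀ b₁ t rfl rfl ht) hP' hGK hE1' hE2').2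


open Summit.AtomisticToContinuum.FouriersLaw.Theses.OddSectorIrreversibility in
/-- **`WitnessGlue` (stmt-AtomisticToContinuum-15160), unconditionally**: the support
`CorrectorTheory` is PROVED in the tree (`Corrector.CorrectorTheory_proof`,
`OddSectorIrreversibilityCorrectorTheoryUniformMixing.lean`). [folklore] -/
theorem witnessGlue_proof : WitnessGlue :=
  witnessGlue_of_correctorTheory
    Summit.AtomisticToContinuum.FouriersLaw.Theorems.OddSectorIrreversibility.Corrector.CorrectorTheory_proof

end Summit.AtomisticToContinuum.FouriersLaw.Theorems.OddSectorWitness.TapLeak
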